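import Mathlib
import HarnessLib

/-!
# Neumann finite-range pieces of a uniformly gapped finite-range symmetric matrix:
# range, entrywise locality, positivity and geometric decay (NFRD-A)

Helper file for crux `Summit.QuantumFields.YangMills.Theses.UnitScaleTilt.FluctuationComparisonRegPrIntL`
(item stmt-QuantumFields-20520), `--supports`, hypothesis form, **definition-free**.  First of two
files proving, token for token, the ideator's (ym-r3-idea-1 g19) first lemma `NeumannFRD` /
`NeumannFRDFamilyLocal` of crux idea `neumann-frd-step`
(`Cruxes/FluctuationComparisonRegPrIntL/NeumannFRDSketch.lean`, card `Ideas/neumann-frd-step.md`;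
LOCATE-GAS1-REP §2c, the FINITE-RANGE route for GAS₁ of LINE g19-2 `Lines/loop_ledger.lean`).
The companion file `…S2BetaNeumannFRD` adds the Neumann series and the two `Prop`s by text.

**Mathematics.**  `ι` a finite index set with a pseudo-metric `dist : ι → ι → ℕ` (zero
self-distance, triangle inequality); a matrix `X` has RANGE `r` if `X a c = 0` whenever
`r < dist a c`.  The Neumann pieces of `M` are the powers of `X := 1 - B⁻¹ • M`.

* §1 RANGE (`pow_apply_eq_zero_of_lt_dist`): powers of a range-`r` matrix have range `r t`.
* §2 LOCALITY (`pow_apply_eq_of_agree`, `neumannPiece_apply_eq_of_agree`): if `M, M'` both have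
  range `r` and agree on all pairs `(x, y)` with `dist a x ≤ r t`, `dist a y ≤ r t`, then
  `(X ^ t) a c = (X' ^ t) a c` for every `c` — the entry of the `t`-th piece at `a` is a function of
  the entries of `M` within `r t` of `a` (radius `r t`, not `2 r t`: the card's falsifier (a)).
* §3 FORMS (`sq_dotProduct_mulVec_le`, `dotProduct_pow_mulVec_bounds`, `abs_pow_apply_le`): for `X`
  symmetric with `0 ≤ zᵀ X z ≤ λ ‖z‖²`, `0 ≤ λ`: `0 ≤ zᵀ X^t z ≤ λ^t ‖z‖²` and `|(X^t) a c| ≤ λ^t`,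
  by the two-step induction `q_{t+2}(z) = q_t(X z)` and CAUCHY–SCHWARZ for the positive
  semi-definite symmetric form `xᵀ X y` (Mathlib `discrim_le_zero`) — no spectral theorem; and
  (`dotProduct_one_sub_smul_mulVec_bounds`) `m‖z‖² ≤ zᵀMz ≤ B‖z‖²`, `0 < B` give these hypotheses
  for `X = 1 - B⁻¹ • M` with `λ = 1 - m / B`; the pieces are symmetric (`isSymm_neumannPiece`)
  and `B⁻¹ • X^t` is `Matrix.PosSemidef` (`posSemidef_neumannPiece`).

Sources: Neumann / polynomial finite-range decompositions [cite: Bauerschmidt2013, arXiv:1206.2212,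
§1 and Thm 1.2] and [cite: BrydgesGuadagniMitter2004, arXiv:math-ph/0303013, §1–2]; the step being
re-routed is [cite: Balaban1985UV3, §A (25)–(37)].

HONEST LABEL.  Linear algebra over `Matrix ι ι ℝ` supplying NO estimate of the lane: not GAS₁, not
REP, not E′, not (OPL); nothing of `FluctuationComparisonRegPrIntL` (20520) is proved here.  Rung R3
(YM₃ = SU(2) on T³) is NOT d = 4, NOT infinite volume, NOT a mass gap, NOT the Clay problem.
-/

namespace Summit.QuantumFields.YangMills.Theorems.FluctuationComparisonRegPrIntLS2BetaNeumannFRDPieces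

open Matrix Finset

variable {ι : Type*} [Fintype ι]

/-! ## §3a Quadratic forms of a symmetric matrix (no `DecidableEq` needed) -/

/-- `∑ a, ∑ c, x a * M a c * y c = x ⬝ᵥ M *ᵥ y` (the sketch's double-sum format). -/
theorem sum_sum_mul_eq_dotProduct_mulVec (M : Matrix ι ι ℝ) (x y : ι → ℝ) :
    ∑ a, ∑ c, x a * M a c * y c = x ⬝ᵥ M *ᵥ y := by
  simp only [dotProduct, Matrix.mulVec, Finset.mul_sum, mul_assoc]

/-- `∑ a, x a ^ 2 = x ⬝ᵥ x`. -/
theorem sum_sq_eq_dotProduct (x : ι → ℝ) : ∑ a, x a ^ 2 = x ⬝ᵥ x := by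
  simp only [dotProduct, sq]

/-- For a symmetric matrix the form `x ⬝ᵥ A *ᵥ y` is symmetric in `x, y`. -/
theorem dotProduct_mulVec_comm_of_isSymm {A : Matrix ι ι ℝ} (hA : A.IsSymm) (x y : ι → ℝ) :
    y ⬝ᵥ A *ᵥ x = x ⬝ᵥ A *ᵥ y := by
  rw [Matrix.dotProduct_mulVec, ← Matrix.mulVec_transpose, hA.eq, dotProduct_comm]

/-- CAUCHY–SCHWARZ for a positive semi-definite symmetric form:
`(x ⬝ᵥ A *ᵥ y) ^ 2 ≤ (x ⬝ᵥ A *ᵥ x) * (y ⬝ᵥ A *ᵥ y)` (discriminant of `s ↦ (x + s y)ᵀ A (x + s y)`,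
Mathlib `discrim_le_zero`). -/
theorem sq_dotProduct_mulVec_le {A : Matrix ι ι ℝ} (hA : A.IsSymm) (h0 : ∀ z, 0 ≤ z ⬝ᵥ A *ᵥ z)
    (x y : ι → ℝ) : (x ⬝ᵥ A *ᵥ y) ^ 2 ≤ (x ⬝ᵥ A *ᵥ x) * (y ⬝ᵥ A *ᵥ y) := by
  have hxy : y ⬝ᵥ A *ᵥ x = x ⬝ᵥ A *ᵥ y := dotProduct_mulVec_comm_of_isSymm hA x y
  have key : ∀ s : ℝ,
      0 ≤ (y ⬝ᵥ A *ᵥ y) * (s * s) + (2 * (x ⬝ᵥ A *ᵥ y)) * s + (x ⬝ᵥ A *ᵥ x) := by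
    intro s
    have := h0 (x + s • y)
    simp only [Matrix.mulVec_add, Matrix.mulVec_smul, add_dotProduct, dotProduct_add,
      dotProduct_smul, smul_dotProduct, smul_eq_mul, hxy] at this
    nlinarith [this]
  have hd := discrim_le_zero key
  rw [discrim] at hd
  nlinarith [hd]

/-- THE OPERATOR BOUND FROM THE FORM BOUND: if `A` is symmetric with
`0 ≤ z ⬝ᵥ A *ᵥ z ≤ lam * (z ⬝ᵥ z)` for all `z`, then `(A *ᵥ z) ⬝ᵥ (A *ᵥ z) ≤ lam ^ 2 * (z ⬝ᵥ z)`. -/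
theorem mulVec_dotProduct_mulVec_le {A : Matrix ι ι ℝ} (hA : A.IsSymm) {lam : ℝ}
    (h0 : ∀ z, 0 ≤ z ⬝ᵥ A *ᵥ z) (h1 : ∀ z, z ⬝ᵥ A *ᵥ z ≤ lam * (z ⬝ᵥ z)) (z : ι → ℝ) :
    (A *ᵥ z) ⬝ᵥ (A *ᵥ z) ≤ lam ^ 2 * (z ⬝ᵥ z) := by
  have hcs := sq_dotProduct_mulVec_le hA h0 z (A *ᵥ z)
  have he : z ⬝ᵥ A *ᵥ (A *ᵥ z) = (A *ᵥ z) ⬝ᵥ (A *ᵥ z) := by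
    rw [Matrix.dotProduct_mulVec, ← Matrix.mulVec_transpose, hA.eq]
  rw [he] at hcs
  have hz := h1 z
  have hAz := h1 (A *ᵥ z)
  have hz0 : 0 ≤ z ⬝ᵥ z := Finset.sum_nonneg fun i _ => mul_self_nonneg (z i)
  have hS0 : 0 ≤ (A *ᵥ z) ⬝ᵥ (A *ᵥ z) :=
    Finset.sum_nonneg fun i _ => mul_self_nonneg ((A *ᵥ z) i)
  by_cases hS : (A *ᵥ z) ⬝ᵥ (A *ᵥ z) = 0
  · rw [hS]; positivity
  · have hSpos : 0 < (A *ᵥ z) ⬝ᵥ (A *ᵥ z) := lt_of_le_of_ne hS0 (Ne.symm hS)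
    have hlam : 0 ≤ lam := by
      by_contra hneg
      have hneg' : lam < 0 := lt_of_not_ge hneg
      have : lam * ((A *ᵥ z) ⬝ᵥ (A *ᵥ z)) < 0 := mul_neg_of_neg_of_pos hneg' hSpos
      linarith [h0 (A *ᵥ z)]
    have hprod : (z ⬝ᵥ A *ᵥ z) * ((A *ᵥ z) ⬝ᵥ A *ᵥ (A *ᵥ z)) ≤
        (lam * (z ⬝ᵥ z)) * (lam * ((A *ᵥ z) ⬝ᵥ (A *ᵥ z))) :=
      mul_le_mul hz hAz (h0 _) (mul_nonneg hlam hz0)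
    have h3 : ((A *ᵥ z) ⬝ᵥ (A *ᵥ z)) * ((A *ᵥ z) ⬝ᵥ (A *ᵥ z)) ≤
        (lam ^ 2 * (z ⬝ᵥ z)) * ((A *ᵥ z) ⬝ᵥ (A *ᵥ z)) := by
      calc ((A *ᵥ z) ⬝ᵥ (A *ᵥ z)) * ((A *ᵥ z) ⬝ᵥ (A *ᵥ z))
          = ((A *ᵥ z) ⬝ᵥ (A *ᵥ z)) ^ 2 := (sq _).symm
        _ ≤ (z ⬝ᵥ A *ᵥ z) * ((A *ᵥ z) ⬝ᵥ A *ᵥ (A *ᵥ z)) := hcs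
        _ ≤ (lam * (z ⬝ᵥ z)) * (lam * ((A *ᵥ z) ⬝ᵥ (A *ᵥ z))) := hprod
        _ = (lam ^ 2 * (z ⬝ᵥ z)) * ((A *ᵥ z) ⬝ᵥ (A *ᵥ z)) := by ring
    exact le_of_mul_le_mul_right h3 hSpos

variable [DecidableEq ι]

/-! ## §1 Range of powers of a finite-range matrix -/

/-- A matrix `X` of range `r` for a pseudo-metric `dist` (zero self-distance, triangle
inequality) has powers `X ^ t` of range `r * t`: `(X ^ t) a c = 0` whenever `r * t < dist a c`. -/
theorem pow_apply_eq_zero_of_lt_dist (dist : ι → ι → ℕ) (hd0 : ∀ a, dist a a = 0)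
    (htri : ∀ a b c, dist a c ≤ dist a b + dist b c) (X : Matrix ι ι ℝ) (r : ℕ)
    (hX : ∀ a c, r < dist a c → X a c = 0) :
    ∀ (t : ℕ) (a c : ι), r * t < dist a c → (X ^ t) a c = 0 := by
  intro t
  induction t with
  | zero =>
    intro a c hac
    have hne : a ≠ c := by
      rintro rfl
      simp [hd0] at hac
    simp [Matrix.one_apply_ne hne]
  | succ t ih =>
    intro a c hac
    rw [pow_succ, Matrix.mul_apply]
    refine Finset.sum_eq_zero fun b _ => ?_
    by_cases hab : r * t < dist a b
    · rw [ih a b hab, zero_mul]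
    · by_cases hbc : r < dist b c
      · rw [hX b c hbc, mul_zero]
      · exfalso
        have hab' := not_lt.mp hab
        have hbc' := not_lt.mp hbc
        have := htri a b c
        have h' : r * (t + 1) = r * t + r := by ring
        omega

omit [Fintype ι] in
/-- The matrix `1 - B⁻¹ • M` has the same range `r` as `M` (the identity has range `0`). -/
theorem one_sub_smul_apply_eq_zero_of_lt_dist (dist : ι → ι → ℕ) (hd0 : ∀ a, dist a a = 0)
    (M : Matrix ι ι ℝ) (r : ℕ) (B : ℝ) (hM : ∀ a c, r < dist a c → M a c = 0) :
    ∀ a c, r < dist a c → (1 - B⁻¹ • M) a c = 0 := by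
  intro a c hac
  have hne : a ≠ c := by
    rintro rfl
    simp [hd0] at hac
  simp [Matrix.sub_apply, Matrix.one_apply_ne hne, hM a c hac]

/-- §1 for the Neumann pieces: `((1 - B⁻¹ • M) ^ t) a c = 0` whenever `r * t < dist a c`. -/
theorem neumannPiece_apply_eq_zero_of_lt_dist (dist : ι → ι → ℕ) (hd0 : ∀ a, dist a a = 0)
    (htri : ∀ a b c, dist a c ≤ dist a b + dist b c) (M : Matrix ι ι ℝ) (r : ℕ) (B : ℝ)
    (hM : ∀ a c, r < dist a c → M a c = 0) :
    ∀ (t : ℕ) (a c : ι), r * t < dist a c → ((1 - B⁻¹ • M) ^ t) a c = 0 :=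
  pow_apply_eq_zero_of_lt_dist dist hd0 htri _ r
    (one_sub_smul_apply_eq_zero_of_lt_dist dist hd0 M r B hM)

/-! ## §2 Entrywise locality of the pieces -/

/-- LOCALITY for powers: if `X` and `X'` both have range `r` and agree on all pairs `(x, y)` with
`dist a x ≤ r * t` and `dist a y ≤ r * t`, then `(X ^ t) a c = (X' ^ t) a c` for every `c`. -/
theorem pow_apply_eq_of_agree (dist : ι → ι → ℕ) (hd0 : ∀ a, dist a a = 0)
    (htri : ∀ a b c, dist a c ≤ dist a b + dist b c) (r : ℕ) (X X' : Matrix ι ι ℝ)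
    (hX : ∀ a c, r < dist a c → X a c = 0) (hX' : ∀ a c, r < dist a c → X' a c = 0) (a : ι) :
    ∀ (t : ℕ), (∀ x y, dist a x ≤ r * t → dist a y ≤ r * t → X x y = X' x y) →
      ∀ c, (X ^ t) a c = (X' ^ t) a c := by
  intro t
  induction t with
  | zero => intro _ c; simp
  | succ t ih =>
    intro hagree c
    have hagree' : ∀ x y, dist a x ≤ r * t → dist a y ≤ r * t → X x y = X' x y := by
      intro x y hx hy
      exact hagree x y (le_trans hx (Nat.mul_le_mul_left r (Nat.le_succ t)))
        (le_trans hy (Nat.mul_le_mul_left r (Nat.le_succ t)))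
    rw [pow_succ, pow_succ, Matrix.mul_apply, Matrix.mul_apply]
    refine Finset.sum_congr rfl fun b _ => ?_
    by_cases hab : r * t < dist a b
    · rw [pow_apply_eq_zero_of_lt_dist dist hd0 htri X r hX t a b hab,
        pow_apply_eq_zero_of_lt_dist dist hd0 htri X' r hX' t a b hab, zero_mul, zero_mul]
    · have hab' := not_lt.mp hab
      rw [ih hagree' b]
      by_cases hbc : r < dist b c
      · rw [hX b c hbc, hX' b c hbc]
      · have hbc' := not_lt.mp hbc
        have h' : r * (t + 1) = r * t + r := by ring
        have h1 : dist a b ≤ r * (t + 1) := by omega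
        have h2 : dist a c ≤ r * (t + 1) := by
          have := htri a b c
          omega
        rw [hagree b c h1 h2]

/-- §2 for the Neumann pieces: if `M` and `M'` both have range `r` and agree on all pairs within
`r * t` of `a`, then `((1 - B⁻¹ • M) ^ t) a c = ((1 - B⁻¹ • M') ^ t) a c`. -/
theorem neumannPiece_apply_eq_of_agree (dist : ι → ι → ℕ) (hd0 : ∀ a, dist a a = 0)
    (htri : ∀ a b c, dist a c ≤ dist a b + dist b c) (r : ℕ) (B : ℝ) (M M' : Matrix ι ι ℝ)
    (hM : ∀ a c, r < dist a c → M a c = 0) (hM' : ∀ a c, r < dist a c → M' a c = 0)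
    (t : ℕ) (a c : ι)
    (hagree : ∀ x y, dist a x ≤ r * t → dist a y ≤ r * t → M x y = M' x y) :
    ((1 - B⁻¹ • M) ^ t) a c = ((1 - B⁻¹ • M') ^ t) a c := by
  refine pow_apply_eq_of_agree dist hd0 htri r _ _
    (one_sub_smul_apply_eq_zero_of_lt_dist dist hd0 M r B hM)
    (one_sub_smul_apply_eq_zero_of_lt_dist dist hd0 M' r B hM') a t ?_ c
  intro x y hx hy
  simp [Matrix.sub_apply, hagree x y hx hy]

/-! ## §3b Positivity and geometric decay of the pieces -/

/-- §3 BOUNDS: for `X` symmetric with `0 ≤ z ⬝ᵥ X *ᵥ z ≤ lam * (z ⬝ᵥ z)` and `0 ≤ lam`: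
`0 ≤ z ⬝ᵥ (X ^ t) *ᵥ z ≤ lam ^ t * (z ⬝ᵥ z)` for every `t` (two-step induction
`q_{t+2}(z) = q_t (X z)` and `mulVec_dotProduct_mulVec_le`). -/
theorem dotProduct_pow_mulVec_bounds {X : Matrix ι ι ℝ} (hX : X.IsSymm) {lam : ℝ} (hlam : 0 ≤ lam)
    (h0 : ∀ z, 0 ≤ z ⬝ᵥ X *ᵥ z) (h1 : ∀ z, z ⬝ᵥ X *ᵥ z ≤ lam * (z ⬝ᵥ z)) :
    ∀ (t : ℕ) (z : ι → ℝ), 0 ≤ z ⬝ᵥ (X ^ t) *ᵥ z ∧ z ⬝ᵥ (X ^ t) *ᵥ z ≤ lam ^ t * (z ⬝ᵥ z) := by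
  have hstep : ∀ t (z : ι → ℝ),
      z ⬝ᵥ (X ^ (t + 2)) *ᵥ z = (X *ᵥ z) ⬝ᵥ (X ^ t) *ᵥ (X *ᵥ z) := by
    intro t z
    rw [pow_succ, pow_succ', ← Matrix.mulVec_mulVec, ← Matrix.mulVec_mulVec,
      Matrix.dotProduct_mulVec, ← Matrix.mulVec_transpose, hX.eq]
  intro t
  induction t using Nat.twoStepInduction with
  | zero =>
    intro z
    simp only [pow_zero, Matrix.one_mulVec, one_mul]
    exact ⟨Finset.sum_nonneg fun i _ => mul_self_nonneg (z i), le_rfl⟩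
  | one =>
    intro z
    simp only [pow_one]
    exact ⟨h0 z, h1 z⟩
  | more t ih _ =>
    intro z
    rw [hstep t z]
    obtain ⟨hlo, hhi⟩ := ih (X *ᵥ z)
    refine ⟨hlo, le_trans hhi ?_⟩
    have hsq := mulVec_dotProduct_mulVec_le hX h0 h1 z
    calc lam ^ t * ((X *ᵥ z) ⬝ᵥ (X *ᵥ z)) ≤ lam ^ t * (lam ^ 2 * (z ⬝ᵥ z)) :=
          mul_le_mul_of_nonneg_left hsq (pow_nonneg hlam t)
      _ = lam ^ (t + 2) * (z ⬝ᵥ z) := by ring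

/-- `(Pi.single a 1) ⬝ᵥ A *ᵥ (Pi.single c 1) = A a c`. -/
theorem single_dotProduct_mulVec_single (A : Matrix ι ι ℝ) (a c : ι) :
    (Pi.single a (1 : ℝ)) ⬝ᵥ A *ᵥ (Pi.single c (1 : ℝ)) = A a c := by
  rw [← sum_sum_mul_eq_dotProduct_mulVec]
  simp [Pi.single_apply, Finset.sum_ite_eq']

/-- §3 ENTRY DECAY: under the hypotheses of `dotProduct_pow_mulVec_bounds`,
`|(X ^ t) a c| ≤ lam ^ t` (Cauchy–Schwarz on the form of `X ^ t` at two basis vectors). -/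
theorem abs_pow_apply_le {X : Matrix ι ι ℝ} (hX : X.IsSymm) {lam : ℝ} (hlam : 0 ≤ lam)
    (h0 : ∀ z, 0 ≤ z ⬝ᵥ X *ᵥ z) (h1 : ∀ z, z ⬝ᵥ X *ᵥ z ≤ lam * (z ⬝ᵥ z)) (t : ℕ) (a c : ι) :
    |(X ^ t) a c| ≤ lam ^ t := by
  have hb := dotProduct_pow_mulVec_bounds hX hlam h0 h1 t
  have hcs := sq_dotProduct_mulVec_le (hX.pow t) (fun z => (hb z).1)
    (Pi.single a (1 : ℝ)) (Pi.single c (1 : ℝ))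
  rw [single_dotProduct_mulVec_single] at hcs
  have ha := (hb (Pi.single a (1 : ℝ))).2
  have hc := (hb (Pi.single c (1 : ℝ))).2
  have hc0 := (hb (Pi.single c (1 : ℝ))).1
  have hss : ∀ i : ι, (Pi.single i (1 : ℝ)) ⬝ᵥ (Pi.single i (1 : ℝ)) = 1 := fun i => by simp
  rw [hss, mul_one] at ha hc
  refine abs_le_of_sq_le_sq ?_ (pow_nonneg hlam t)
  calc ((X ^ t) a c) ^ 2
      ≤ (Pi.single a (1:ℝ) ⬝ᵥ (X ^ t) *ᵥ Pi.single a 1) *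
          (Pi.single c (1:ℝ) ⬝ᵥ (X ^ t) *ᵥ Pi.single c 1) := hcs
    _ ≤ lam ^ t * lam ^ t := mul_le_mul ha hc hc0 (pow_nonneg hlam t)
    _ = (lam ^ t) ^ 2 := by ring

/-- The form of `X := 1 - B⁻¹ • M` from the form of `M`: if `m (z ⬝ᵥ z) ≤ z ⬝ᵥ M *ᵥ z ≤ B (z ⬝ᵥ z)`
with `0 < B`, then `0 ≤ z ⬝ᵥ X *ᵥ z ≤ (1 - m / B) * (z ⬝ᵥ z)`. -/
theorem dotProduct_one_sub_smul_mulVec_bounds (M : Matrix ι ι ℝ) {m B : ℝ} (hB : 0 < B)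
    (hlo : ∀ z : ι → ℝ, m * (z ⬝ᵥ z) ≤ z ⬝ᵥ M *ᵥ z)
    (hhi : ∀ z : ι → ℝ, z ⬝ᵥ M *ᵥ z ≤ B * (z ⬝ᵥ z)) (z : ι → ℝ) :
    0 ≤ z ⬝ᵥ (1 - B⁻¹ • M) *ᵥ z ∧ z ⬝ᵥ (1 - B⁻¹ • M) *ᵥ z ≤ (1 - m / B) * (z ⬝ᵥ z) := by
  have hform : z ⬝ᵥ (1 - B⁻¹ • M) *ᵥ z = z ⬝ᵥ z - B⁻¹ * (z ⬝ᵥ M *ᵥ z) := by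
    rw [Matrix.sub_mulVec, Matrix.one_mulVec, Matrix.smul_mulVec, dotProduct_sub,
      dotProduct_smul, smul_eq_mul]
  rw [hform]
  have h1 := hlo z
  have h2 := hhi z
  have hBinv : 0 < B⁻¹ := inv_pos.mpr hB
  constructor
  · have : B⁻¹ * (z ⬝ᵥ M *ᵥ z) ≤ B⁻¹ * (B * (z ⬝ᵥ z)) := mul_le_mul_of_nonneg_left h2 hBinv.le
    rw [← mul_assoc, inv_mul_cancel₀ hB.ne', one_mul] at this
    linarith
  · have : B⁻¹ * (m * (z ⬝ᵥ z)) ≤ B⁻¹ * (z ⬝ᵥ M *ᵥ z) := mul_le_mul_of_nonneg_left h1 hBinv.le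
    have hm : (1 - m / B) * (z ⬝ᵥ z) = z ⬝ᵥ z - B⁻¹ * (m * (z ⬝ᵥ z)) := by
      rw [div_eq_mul_inv]; ring
    rw [hm]
    linarith

omit [Fintype ι] in
/-- `1 - B⁻¹ • M` is symmetric when `M` is. -/
theorem isSymm_one_sub_smul {M : Matrix ι ι ℝ} (hM : M.IsSymm) (B : ℝ) :
    (1 - B⁻¹ • M).IsSymm :=
  Matrix.isSymm_one.sub (hM.smul _)

/-- §3 for the Neumann pieces of `M` (symmetric, `m‖z‖² ≤ zᵀMz ≤ B‖z‖²`, `0 < m ≤ B`):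
`0 ≤ zᵀ (1 - B⁻¹•M)^t z ≤ (1 - m/B)^t ‖z‖²` and `|((1 - B⁻¹•M)^t) a c| ≤ (1 - m/B)^t`. -/
theorem neumannPiece_bounds (M : Matrix ι ι ℝ) (hM : M.IsSymm) {m B : ℝ} (hm : 0 < m)
    (hmB : m ≤ B) (hlo : ∀ z : ι → ℝ, m * (z ⬝ᵥ z) ≤ z ⬝ᵥ M *ᵥ z)
    (hhi : ∀ z : ι → ℝ, z ⬝ᵥ M *ᵥ z ≤ B * (z ⬝ᵥ z)) :
    (∀ (t : ℕ) (z : ι → ℝ), 0 ≤ z ⬝ᵥ ((1 - B⁻¹ • M) ^ t) *ᵥ z ∧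
        z ⬝ᵥ ((1 - B⁻¹ • M) ^ t) *ᵥ z ≤ (1 - m / B) ^ t * (z ⬝ᵥ z)) ∧
      ∀ (t : ℕ) (a c : ι), |((1 - B⁻¹ • M) ^ t) a c| ≤ (1 - m / B) ^ t := by
  have hB : 0 < B := lt_of_lt_of_le hm hmB
  have hlam0 : 0 ≤ 1 - m / B := by
    rw [sub_nonneg, div_le_one hB]; exact hmB
  have hb := dotProduct_one_sub_smul_mulVec_bounds M hB hlo hhi
  exact ⟨dotProduct_pow_mulVec_bounds (isSymm_one_sub_smul hM B) hlam0 (fun z => (hb z).1)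
      (fun z => (hb z).2),
    abs_pow_apply_le (isSymm_one_sub_smul hM B) hlam0 (fun z => (hb z).1) (fun z => (hb z).2)⟩

/-- The Neumann pieces are symmetric: `((1 - B⁻¹ • M) ^ t)ᵀ = (1 - B⁻¹ • M) ^ t` for symmetric `M`
(what a consumer building the finite-range Gaussian sub-fields `ζ_t` needs of a covariance). -/
theorem isSymm_neumannPiece {M : Matrix ι ι ℝ} (hM : M.IsSymm) (B : ℝ) (t : ℕ) :
    ((1 - B⁻¹ • M) ^ t).IsSymm :=
  (isSymm_one_sub_smul hM B).pow t

/-- The SCALED Neumann pieces `Γ_t := B⁻¹ • (1 - B⁻¹ • M) ^ t` are positive semi-definite in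
Mathlib's sense (`Matrix.PosSemidef`), for `M` symmetric with `m‖z‖² ≤ zᵀMz ≤ B‖z‖²`, `0 < m ≤ B`
— the covariance of the `t`-th finite-range sub-field. -/
theorem posSemidef_neumannPiece (M : Matrix ι ι ℝ) (hM : M.IsSymm) {m B : ℝ} (hm : 0 < m)
    (hmB : m ≤ B) (hlo : ∀ z : ι → ℝ, m * (z ⬝ᵥ z) ≤ z ⬝ᵥ M *ᵥ z)
    (hhi : ∀ z : ι → ℝ, z ⬝ᵥ M *ᵥ z ≤ B * (z ⬝ᵥ z)) (t : ℕ) :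
    (B⁻¹ • (1 - B⁻¹ • M) ^ t).PosSemidef := by
  have hB : 0 < B := lt_of_lt_of_le hm hmB
  have hpos := (neumannPiece_bounds M hM hm hmB hlo hhi).1 t
  refine Matrix.PosSemidef.of_dotProduct_mulVec_nonneg ?_ fun x => ?_
  · rw [Matrix.IsHermitian, Matrix.conjTranspose_eq_transpose_of_trivial]
    exact ((isSymm_neumannPiece hM B t).smul B⁻¹).eq
  · rw [star_trivial, Matrix.smul_mulVec, dotProduct_smul, smul_eq_mul]
    exact mul_nonneg (inv_pos.mpr hB).le (hpos x).1

end Summit.QuantumFields.YangMills.Theorems.FluctuationComparisonRegPrIntLS2BetaNeumannFRDPieces
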